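import Summits.BirchSwinnertonDyer.BirchSwinnertonDyer.Theorems.ManinLocalTwoThreePlaneIndexTransport
import Summits.BirchSwinnertonDyer.BirchSwinnertonDyer.Theorems.ManinLocalTwoThreeTranslationNewform
import Literature.NumberTheory.EllipticCurves.PastenSpectralDegreeProofs
import Literature.NumberTheory.EllipticCurves.AtkinLehnerInvolutionsNewformProofs
import HarnessLib

/-!
# The cut lattices `S^G` (Conway, at 2), `M^G` (Conway–Norton, at 3) and `S^T` (translation-stable, at 3) are stable
# under every Hecke operator `T_p`, `p ∤ N` prime

Summit `BirchSwinnertonDyer`, sub-problem `BirchSwinnertonDyer`, route `ManinLocalTwoThree`; width seat `bsd-line-manin23-p2`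
(gen 9), `--supports` the crux C2 `ManinOddAtFour` (stmt-BirchSwinnertonDyer-22967; the `p = 3` lattices bear on C3
stmt-…-22968).  Cell `bsd-f2-manin`: desc's lattices `ConwayCut.conwayStableLattice` (g5), `ConwayNortonThree.conwayNortonLatticeAtThree`,
`….translationStableLatticeAtThree` (g8); imc g18 MEMO-imc §24 / E-imc-127 («stability under `T_ℓ`, `U_p`, `p` odd, is formal» —
made kernel here for the anemic Hecke operators `T_p`, `p ∤ N`).

PROVED here (sorry-free), `p ∤ N` prime throughout:

* `atkinLehnerInvolutionAt_heckeT_of_not_dvd'` — `w_{Q_q} T_p = T_p w_{Q_q}` on all of `S_k(Γ₀(N))` (tree, Knapp 9.24, in the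
  `atkinLehnerInvolutionAt` spelling of the lattices);
* `heckeT_halfTranslate_comm` — `T_p t = t T_p` at `4 ∣ N` (`p` odd: `(−1)^{pn} = (−1)^n`);
* `thirdTranslate_eq_of_modEq_three`, `heckeT_thirdTranslate` — `t_{j/3} = t_{j'/3}` for `j ≡ j' (3)` and
  **`T_p t_{j/3} = t_{pj/3} T_p`** at `9 ∣ N` (so `t_{1/3} T_p = T_p t_{p/3}`; `p² ≡ 1 (3)`);
* `heckeT_twistOperatorAtThree` — `T_p B₃ = χ₋₃(p)·B₃ T_p`, i.e. `= B₃ T_p` (`p ≡ 1 (3)`) or `= −B₃ T_p` (`p ≡ 2 (3)`);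
* **`map_heckeT_conwayStableLattice_le`** (`4 ∣ N`), **`map_heckeT_conwayNortonLatticeAtThree_le`**,
  **`map_heckeT_translationStableLatticeAtThree_le`** (`9 ∣ N`): `T_p L ⊆ L` for the three cut lattices — each by
  maximality: `T_p L` satisfies the defining closure conditions (integrality `heckeT_mem_integralCuspForms0`, the
  commutations above).

Elementary `q`-expansion bookkeeping (Diamond–Shurman Prop. 5.2.2; Atkin–Lehner 1970 §4).  BSD is not proved by this;
Manin's conjecture is not proved by this.
-/

set_option autoImplicit false
set_option linter.dupNamespace false

noncomputable section

open scoped MatrixGroups ModularForm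
open CongruenceSubgroup
open Literature.NumberTheory.EllipticCurves Literature.NumberTheory.EllipticCurves.ModularForms
open Summit.BirchSwinnertonDyer.Rank1Residual.ManinAdditive
open Summit.BirchSwinnertonDyer.Rank1Residual.ManinAdditive.ConwayCut
open Summit.BirchSwinnertonDyer.Rank1Residual.ManinAdditive.RamanujanCut
open Summit.BirchSwinnertonDyer.Rank1Residual.ManinAdditive.ConwayNortonThree

namespace Summit.BirchSwinnertonDyer.BirchSwinnertonDyer.Theorems.ManinLocalTwoThree

variable {N : ℕ} [NeZero N]

/-! ### Commutations -/

/-- `w_{Q_q} T_p = T_p w_{Q_q}` on `S_k(Γ₀(N))` for primes `q ∣ N`, `p ∤ N` (tree `atkinLehnerInvolution_heckeT_of_not_dvd`,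
Knapp 1993 Lemma 9.24, respelled for `atkinLehnerInvolutionAt`). -/
theorem atkinLehnerInvolutionAt_heckeT_of_not_dvd' {k : ℤ} {q : ℕ} (hq : q.Prime) (hqN : q ∣ N) {p : ℕ} [NeZero p]
    (hp : p.Prime) (hpN : ¬ p ∣ N) (f : CuspForm (Gamma0 N) k) :
    atkinLehnerInvolutionAt N k q (heckeT (Gamma0 N) k p f) = heckeT (Gamma0 N) k p (atkinLehnerInvolutionAt N k q f) := by
  haveI : NeZero (q ^ N.factorization q) := ⟨(Nat.ordProj_pos N q).ne'⟩
  obtain ⟨hQN, hcQ⟩ := ordProj_dvd_and_coprime N (Nat.mem_primeFactors.mpr ⟨hq, hqN, NeZero.ne N⟩)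
  rw [atkinLehnerInvolutionAt_eq (N := N) (k := k) (p := q) rfl]
  have h := atkinLehnerInvolution_heckeT_of_not_dvd N k (q ^ N.factorization q) hQN hcQ hp hpN f
  convert h using 2

/-- `aₙ(T_p f)` at weight `2`: `a_{pn}(f) + 𝟙_{p ∤ N} · p · 𝟙_{p ∣ n} · a_{n/p}(f)` (tree `qExpansion_coeff_heckeT_holds`). -/
theorem cuspCoeff_heckeT_weight_two {p : ℕ} [NeZero p] (hp : p.Prime) (f : CuspForm (Gamma0 N) 2) (n : ℕ) :
    cuspCoeff (heckeT (Gamma0 N) 2 p f) n =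
      cuspCoeff f (p * n) + (if p ∣ N then 0 else (p : ℂ) * (if p ∣ n then cuspCoeff f (n / p) else 0)) := by
  have e := qExpansion_coeff_heckeT_holds N 2 f p hp n
  rw [show ((2 : ℤ) - 1) = 1 by norm_num, zpow_one] at e
  exact e

/-- **`T_p t = t T_p`** for the half-translation `t` (`4 ∣ N`, `p` an odd prime): on `q`-expansions both sides read
`(−1)ⁿ (a_{pn} + 𝟙 p a_{n/p})` since `(−1)^{pn} = (−1)ⁿ` and `(−1)^{n/p} = (−1)ⁿ` for `p ∣ n`. -/
theorem heckeT_halfTranslate_comm (h4 : 4 ∣ N) {p : ℕ} [NeZero p] (hp : p.Prime) (hp2 : p ≠ 2)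
    (f : CuspForm (Gamma0 N) 2) :
    heckeT (Gamma0 N) 2 p (halfTranslate N 2 f) = halfTranslate N 2 (heckeT (Gamma0 N) 2 p f) := by
  have hpodd : Odd p := hp.odd_of_ne_two hp2
  refine eq_of_forall_cuspCoeff_eq_gamma0 fun n => ?_
  simp only [cuspCoeff_heckeT_weight_two hp, cuspCoeff_halfTranslate_two h4]
  have h1 : ((-1 : ℂ)) ^ (p * n) = (-1) ^ n := by
    rw [pow_mul, hpodd.neg_one_pow]
  by_cases hpn : p ∣ n
  · obtain ⟨m, rfl⟩ := hpn
    have h2 : ((-1 : ℂ)) ^ (p * m / p) = (-1) ^ (p * m) := by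
      rw [Nat.mul_div_cancel_left m hp.pos, pow_mul, hpodd.neg_one_pow]
    rw [if_pos (dvd_mul_right p m), if_pos (dvd_mul_right p m), h1, h2]
    split_ifs <;> ring
  · rw [if_neg hpn, if_neg hpn, h1]
    split_ifs <;> ring

/-- `t_{j/3} = t_{j'/3}` whenever `j ≡ j' (mod 3)` (`9 ∣ N`, weight `2`): both multiply `aₙ` by `ζ₃^{jn} = ζ₃^{j'n}`. -/
theorem thirdTranslate_eq_of_modEq_three (h9 : 9 ∣ N) {j j' : ℕ} (hjj : j % 3 = j' % 3) (f : CuspForm (Gamma0 N) 2) :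
    thirdTranslate N 2 j f = thirdTranslate N 2 j' f := by
  have h3 : zeta3 ^ 3 = 1 := isPrimitiveRoot_zeta3.pow_eq_one
  have hz : zeta3 ^ j = zeta3 ^ j' := by
    rw [← Nat.div_add_mod j 3, ← Nat.div_add_mod j' 3, pow_add, pow_add, pow_mul, pow_mul, h3, one_pow, one_pow,
      one_mul, one_mul, hjj]
  refine eq_of_forall_cuspCoeff_eq_gamma0 fun n => ?_
  rw [cuspCoeff_thirdTranslate_two h9, cuspCoeff_thirdTranslate_two h9, hz]

/-- **`T_p t_{j/3} = t_{pj/3} T_p`** (`9 ∣ N`, `p ∤ N` hence `p ≠ 3`): `aₙ(T_p t_j f) = ζ₃^{jpn} a_{pn} + 𝟙 p ζ₃^{j n/p} a_{n/p}`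
and `ζ₃^{j·n/p} = ζ₃^{pj·n}` because `p² ≡ 1 (mod 3)`. -/
theorem heckeT_thirdTranslate (h9 : 9 ∣ N) {p : ℕ} [NeZero p] (hp : p.Prime) (hp3 : p ≠ 3) (j : ℕ)
    (f : CuspForm (Gamma0 N) 2) :
    heckeT (Gamma0 N) 2 p (thirdTranslate N 2 j f) = thirdTranslate N 2 (p * j) (heckeT (Gamma0 N) 2 p f) := by
  have h3 : zeta3 ^ 3 = 1 := isPrimitiveRoot_zeta3.pow_eq_one
  -- `p² ≡ 1 (mod 3)`
  have hp2 : p ^ 2 % 3 = 1 := by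
    have h := Nat.pos_of_ne_zero (show p % 3 ≠ 0 from fun h0 =>
      hp3 ((Nat.prime_dvd_prime_iff_eq Nat.prime_three hp).mp (Nat.dvd_of_mod_eq_zero h0)).symm)
    have hlt : p % 3 < 3 := Nat.mod_lt _ (by norm_num)
    rw [Nat.pow_mod]
    interval_cases (p % 3) <;> norm_num
  refine eq_of_forall_cuspCoeff_eq_gamma0 fun n => ?_
  simp only [cuspCoeff_heckeT_weight_two hp, cuspCoeff_thirdTranslate_two h9]
  have hA : (zeta3 ^ j) ^ (p * n) = (zeta3 ^ (p * j)) ^ n := by rw [← pow_mul, ← pow_mul]; ring_nf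
  by_cases hpn : p ∣ n
  · obtain ⟨m, rfl⟩ := hpn
    have hB : (zeta3 ^ j) ^ (p * m / p) = (zeta3 ^ (p * j)) ^ (p * m) := by
      rw [Nat.mul_div_cancel_left m hp.pos, ← pow_mul, ← pow_mul]
      -- `ζ₃^{j m} = ζ₃^{p² j m}` since `p² = 3t + 1`
      have e : p ^ 2 = 3 * (p ^ 2 / 3) + 1 := by
        have := Nat.div_add_mod (p ^ 2) 3
        omega
      have ht : p * j * (p * m) = 3 * (p ^ 2 / 3 * (j * m)) + j * m := by
        calc p * j * (p * m) = p ^ 2 * (j * m) := by ring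
          _ = (3 * (p ^ 2 / 3) + 1) * (j * m) := by rw [← e]
          _ = 3 * (p ^ 2 / 3 * (j * m)) + j * m := by ring
      rw [ht, pow_add, pow_mul zeta3 3, h3, one_pow, one_mul, pow_mul]
    rw [if_pos (dvd_mul_right p m), if_pos (dvd_mul_right p m), hA, hB]
    split_ifs <;> ring
  · rw [if_neg hpn, if_neg hpn, hA]
    split_ifs <;> ring

/-- **`T_p B₃ = χ₋₃(p) B₃ T_p`**: `T_p (B₃ x) = B₃ (T_p x)` if `p ≡ 1 (mod 3)` and `= −B₃ (T_p x)` if `p ≡ 2 (mod 3)`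
(`9 ∣ N`, `p ∤ N`). -/
theorem heckeT_twistOperatorAtThree (h9 : 9 ∣ N) {p : ℕ} [NeZero p] (hp : p.Prime) (hp3 : p ≠ 3)
    (x : CuspForm (Gamma0 N) 2) :
    heckeT (Gamma0 N) 2 p (twistOperatorAtThree N 2 x) =
      (if p % 3 = 1 then (1 : ℂ) else -1) • twistOperatorAtThree N 2 (heckeT (Gamma0 N) 2 p x) := by
  have hmod : p % 3 = 1 ∨ p % 3 = 2 := by
    have h0 : p % 3 ≠ 0 := fun h0 =>
      hp3 ((Nat.prime_dvd_prime_iff_eq Nat.prime_three hp).mp (Nat.dvd_of_mod_eq_zero h0)).symm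
    have hlt : p % 3 < 3 := Nat.mod_lt _ (by norm_num)
    omega
  have hB : ∀ y : CuspForm (Gamma0 N) 2, twistOperatorAtThree N 2 y =
      (zeta3 - zeta3 ^ 2)⁻¹ • (thirdTranslate N 2 1 y - thirdTranslate N 2 2 y) := fun y => by
    simp only [twistOperatorAtThree, LinearMap.smul_apply, LinearMap.sub_apply]
  rw [hB, hB, map_smul, map_sub, heckeT_thirdTranslate h9 hp hp3 1, heckeT_thirdTranslate h9 hp hp3 2, mul_one]
  rcases hmod with h1 | h2
  · rw [if_pos h1, one_smul, thirdTranslate_eq_of_modEq_three h9 (j := p) (j' := 1) (by simpa using h1),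
      thirdTranslate_eq_of_modEq_three h9 (j := p * 2) (j' := 2) (by simp [Nat.mul_mod, h1])]
  · rw [if_neg (by omega), thirdTranslate_eq_of_modEq_three h9 (j := p) (j' := 2) (by simpa using h2),
      thirdTranslate_eq_of_modEq_three h9 (j := p * 2) (j' := 1) (by simp [Nat.mul_mod, h2]),
      neg_one_smul, ← smul_neg, neg_sub]

/-! ### Hecke stability of the three cut lattices -/

/-- **`T_p S^G ⊆ S^G`** (`4 ∣ N`, `p ∤ N` prime): `T_p S^G` is integral, `w_Q`-stable and `t`-stable, hence below the
largest such lattice. -/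
theorem map_heckeT_conwayStableLattice_le (h4 : 4 ∣ N) {p : ℕ} [NeZero p] (hp : p.Prime) (hpN : ¬ p ∣ N) :
    (conwayStableLattice N).map ((heckeT (Gamma0 N) 2 p).restrictScalars ℤ) ≤ conwayStableLattice N := by
  have hp2 : p ≠ 2 := by
    rintro rfl
    exact hpN ((show (2 : ℕ) ∣ 4 by norm_num).trans h4)
  have hS : ∀ M ∈ {M : Submodule ℤ (CuspForm (Gamma0 N) 2) | M ≤ integralCuspForms0 N 2 ∧ (∀ q : ℕ, q.Prime → q ∣ N →
      M.map ((atkinLehnerInvolutionAt N 2 q).restrictScalars ℤ) ≤ M) ∧ M.map ((halfTranslate N 2).restrictScalars ℤ) ≤ M},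
      M ≤ conwayStableLattice N := fun M hM => le_sSup hM
  have hmem : ∀ x ∈ conwayStableLattice N, x ∈ integralCuspForms0 N 2 ∧
      (∀ q : ℕ, q.Prime → q ∣ N → atkinLehnerInvolutionAt N 2 q x ∈ conwayStableLattice N) ∧
      halfTranslate N 2 x ∈ conwayStableLattice N := by
    intro x hx
    refine ⟨(show conwayStableLattice N ≤ integralCuspForms0 N 2 from sSup_le fun M hM => hM.1) hx,
      fun q hq hqN => ?_, ?_⟩
    · have h : (conwayStableLattice N).map ((atkinLehnerInvolutionAt N 2 q).restrictScalars ℤ) ≤ conwayStableLattice N := by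
        unfold conwayStableLattice
        rw [Submodule.map_le_iff_le_comap]
        exact sSup_le fun M hM => Submodule.map_le_iff_le_comap.mp ((hM.2.1 q hq hqN).trans (le_sSup hM))
      exact h ⟨x, hx, rfl⟩
    · have h : (conwayStableLattice N).map ((halfTranslate N 2).restrictScalars ℤ) ≤ conwayStableLattice N := by
        unfold conwayStableLattice
        rw [Submodule.map_le_iff_le_comap]
        exact sSup_le fun M hM => Submodule.map_le_iff_le_comap.mp (hM.2.2.trans (le_sSup hM))
      exact h ⟨x, hx, rfl⟩
  refine hS _ ⟨?_, ?_, ?_⟩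
  · rintro _ ⟨x, hx, rfl⟩
    exact heckeT_mem_integralCuspForms0 p hp hpN (hmem x hx).1
  · rintro q hq hqN _ ⟨_, ⟨x, hx, rfl⟩, rfl⟩
    refine ⟨atkinLehnerInvolutionAt N 2 q x, (hmem x hx).2.1 q hq hqN, ?_⟩
    change heckeT (Gamma0 N) 2 p (atkinLehnerInvolutionAt N 2 q x) = atkinLehnerInvolutionAt N 2 q (heckeT (Gamma0 N) 2 p x)
    exact (atkinLehnerInvolutionAt_heckeT_of_not_dvd' hq hqN hp hpN x).symm
  · rintro _ ⟨_, ⟨x, hx, rfl⟩, rfl⟩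
    refine ⟨halfTranslate N 2 x, (hmem x hx).2.2, ?_⟩
    change heckeT (Gamma0 N) 2 p (halfTranslate N 2 x) = halfTranslate N 2 (heckeT (Gamma0 N) 2 p x)
    exact heckeT_halfTranslate_comm h4 hp hp2 x

/-- **`T_p M^G ⊆ M^G`** (`9 ∣ N`, `p ∤ N` prime): `T_p M^G` lies in `S ⊗ ℤ[ζ₃]`, is `ζ₃`-, `w_Q`- and `t_{1/3}`-stable
(`t_{1/3} T_p = T_p t_{p/3}` and `t_{p/3} ∈ {t_{1/3}, t_{1/3}²}`), hence below the largest such lattice. -/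
theorem map_heckeT_conwayNortonLatticeAtThree_le (h9 : 9 ∣ N) {p : ℕ} [NeZero p] (hp : p.Prime) (hpN : ¬ p ∣ N) :
    (conwayNortonLatticeAtThree N).map ((heckeT (Gamma0 N) 2 p).restrictScalars ℤ) ≤ conwayNortonLatticeAtThree N := by
  have hp3 : p ≠ 3 := by
    rintro rfl
    exact hpN ((show (3 : ℕ) ∣ 9 by norm_num).trans h9)
  -- `t_{p/3} x ∈ M^G` for `x ∈ M^G`
  have htp : ∀ x ∈ conwayNortonLatticeAtThree N, thirdTranslate N 2 p x ∈ conwayNortonLatticeAtThree N := by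
    intro x hx
    have hmod : p % 3 = 1 ∨ p % 3 = 2 := by
      have h0 : p % 3 ≠ 0 := fun h0 =>
        hp3 ((Nat.prime_dvd_prime_iff_eq Nat.prime_three hp).mp (Nat.dvd_of_mod_eq_zero h0)).symm
      have hlt : p % 3 < 3 := Nat.mod_lt _ (by norm_num)
      omega
    rcases hmod with h1 | h2
    · rw [thirdTranslate_eq_of_modEq_three h9 (j' := 1) (by simpa using h1)]
      exact thirdTranslate_one_mem_conwayNortonLatticeAtThree hx
    · rw [thirdTranslate_eq_of_modEq_three h9 (j' := 2) (by simpa using h2), thirdTranslate_two_eq_comp h9,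
        LinearMap.comp_apply]
      exact thirdTranslate_one_mem_conwayNortonLatticeAtThree (thirdTranslate_one_mem_conwayNortonLatticeAtThree hx)
  refine le_conwayNortonLatticeAtThree ?_ ?_ ?_ ?_
  · rintro _ ⟨x, hx, rfl⟩
    obtain ⟨s₁, hs₁, w, hw, hsw⟩ := Submodule.mem_sup.mp (conwayNortonLatticeAtThree_le hx)
    obtain ⟨s₂, hs₂, rfl⟩ := Submodule.mem_map.mp hw
    change heckeT (Gamma0 N) 2 p x ∈ _
    rw [← hsw, map_add]
    refine Submodule.add_mem _ (Submodule.mem_sup_left (heckeT_mem_integralCuspForms0 p hp hpN hs₁))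
      (Submodule.mem_sup_right ⟨heckeT (Gamma0 N) 2 p s₂, heckeT_mem_integralCuspForms0 p hp hpN hs₂, ?_⟩)
    change zeta3 • heckeT (Gamma0 N) 2 p s₂ = heckeT (Gamma0 N) 2 p (zeta3 • s₂)
    rw [map_smul]
  · rintro _ ⟨_, ⟨x, hx, rfl⟩, rfl⟩
    refine ⟨zeta3 • x, zeta3_smul_mem_conwayNortonLatticeAtThree hx, ?_⟩
    change heckeT (Gamma0 N) 2 p (zeta3 • x) = zeta3 • heckeT (Gamma0 N) 2 p x
    rw [map_smul]
  · rintro q hq hqN _ ⟨_, ⟨x, hx, rfl⟩, rfl⟩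
    refine ⟨atkinLehnerInvolutionAt N 2 q x, atkinLehnerInvolutionAt_mem_conwayNortonLatticeAtThree hq hqN hx, ?_⟩
    change heckeT (Gamma0 N) 2 p (atkinLehnerInvolutionAt N 2 q x) = atkinLehnerInvolutionAt N 2 q (heckeT (Gamma0 N) 2 p x)
    exact (atkinLehnerInvolutionAt_heckeT_of_not_dvd' hq hqN hp hpN x).symm
  · rintro _ ⟨_, ⟨x, hx, rfl⟩, rfl⟩
    refine ⟨thirdTranslate N 2 p x, htp x hx, ?_⟩
    change heckeT (Gamma0 N) 2 p (thirdTranslate N 2 p x) = thirdTranslate N 2 1 (heckeT (Gamma0 N) 2 p x)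
    rw [heckeT_thirdTranslate h9 hp hp3 p, thirdTranslate_eq_of_modEq_three h9 (j := p * p) (j' := 1)]
    -- `p² ≡ 1 (mod 3)`
    have h0 : p % 3 ≠ 0 := fun h0 =>
      hp3 ((Nat.prime_dvd_prime_iff_eq Nat.prime_three hp).mp (Nat.dvd_of_mod_eq_zero h0)).symm
    have hlt : p % 3 < 3 := Nat.mod_lt _ (by norm_num)
    rw [Nat.mul_mod]
    interval_cases (p % 3) <;> simp_all

/-- **`T_p S^T ⊆ S^T`** (`9 ∣ N`, `p ∤ N` prime): `T_p S^T` is integral, `w_Q`-stable, `B₃`-stable (`B₃ T_p = ±T_p B₃`) and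
`A₃`-stable (`A₃ T_p x = T_p (A₃ x)` or `T_p (A₃ x − B₃ x)` according as `p ≡ 1, 2 (mod 3)`), hence below the largest such
lattice. -/
theorem map_heckeT_translationStableLatticeAtThree_le (h9 : 9 ∣ N) {p : ℕ} [NeZero p] (hp : p.Prime)
    (hpN : ¬ p ∣ N) :
    (translationStableLatticeAtThree N).map ((heckeT (Gamma0 N) 2 p).restrictScalars ℤ) ≤
      translationStableLatticeAtThree N := by
  have hp3 : p ≠ 3 := by
    rintro rfl
    exact hpN ((show (3 : ℕ) ∣ 9 by norm_num).trans h9)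
  have hmod : p % 3 = 1 ∨ p % 3 = 2 := by
    have h0 : p % 3 ≠ 0 := fun h0 =>
      hp3 ((Nat.prime_dvd_prime_iff_eq Nat.prime_three hp).mp (Nat.dvd_of_mod_eq_zero h0)).symm
    have hlt : p % 3 < 3 := Nat.mod_lt _ (by norm_num)
    omega
  set L := translationStableLatticeAtThree N with hLdef
  -- closure properties of `S^T`
  have hLS : L ≤ integralCuspForms0 N 2 := translationStableLatticeAtThree_le
  have hLw : ∀ q : ℕ, q.Prime → q ∣ N → ∀ x ∈ L, atkinLehnerInvolutionAt N 2 q x ∈ L := by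
    intro q hq hqN x hx
    have h : L.map ((atkinLehnerInvolutionAt N 2 q).restrictScalars ℤ) ≤ L := by
      rw [hLdef]; unfold translationStableLatticeAtThree
      rw [Submodule.map_le_iff_le_comap]
      exact sSup_le fun M hM => Submodule.map_le_iff_le_comap.mp ((hM.2.1 q hq hqN).trans (le_sSup hM))
    exact h ⟨x, hx, rfl⟩
  have hLA : ∀ x ∈ L, diagonalOperatorAtThree N 2 x ∈ L := by
    intro x hx
    have h : L.map ((diagonalOperatorAtThree N 2).restrictScalars ℤ) ≤ L := by
      rw [hLdef]; unfold translationStableLatticeAtThree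
      rw [Submodule.map_le_iff_le_comap]
      exact sSup_le fun M hM => Submodule.map_le_iff_le_comap.mp (hM.2.2.1.trans (le_sSup hM))
    exact h ⟨x, hx, rfl⟩
  have hLB : ∀ x ∈ L, twistOperatorAtThree N 2 x ∈ L := fun x hx =>
    map_twistOperatorAtThree_translationStableLatticeAtThree_le ⟨x, hx, rfl⟩
  -- `T_p B₃ x = ± B₃ T_p x`
  have hTB : ∀ x, twistOperatorAtThree N 2 (heckeT (Gamma0 N) 2 p x) =
      (if p % 3 = 1 then (1 : ℂ) else -1) • heckeT (Gamma0 N) 2 p (twistOperatorAtThree N 2 x) := by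
    intro x
    rw [heckeT_twistOperatorAtThree h9 hp hp3, smul_smul]
    split_ifs <;> norm_num
  -- `t_{1/3} T_p x = T_p t_{p/3} x`, and `t_{p/3} = A₃ + ζ₃^{p} B₃`-type formulas
  have ht1 : ∀ y, thirdTranslate N 2 1 y = diagonalOperatorAtThree N 2 y + zeta3 • twistOperatorAtThree N 2 y := by
    intro y
    simp only [diagonalOperatorAtThree, LinearMap.sub_apply, LinearMap.smul_apply, sub_add_cancel]
  have ht2 : ∀ y, thirdTranslate N 2 2 y = diagonalOperatorAtThree N 2 y + zeta3 ^ 2 • twistOperatorAtThree N 2 y := by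
    intro y
    have h := smul_twistOperatorAtThree_eq_sub 2 y
    rw [ht1] at h
    -- `t₂ y = t₁ y − (ζ₃ − ζ₃²) B₃ y`
    have : thirdTranslate N 2 2 y =
        diagonalOperatorAtThree N 2 y + zeta3 • twistOperatorAtThree N 2 y - (zeta3 - zeta3 ^ 2) • twistOperatorAtThree N 2 y := by
      rw [h]; abel
    rw [this, sub_smul]
    abel
  rw [hLdef]
  unfold translationStableLatticeAtThree
  refine le_sSup ⟨?_, ?_, ?_, ?_⟩
  · rintro _ ⟨x, hx, rfl⟩
    exact heckeT_mem_integralCuspForms0 p hp hpN (hLS hx)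
  · rintro q hq hqN _ ⟨_, ⟨x, hx, rfl⟩, rfl⟩
    refine ⟨atkinLehnerInvolutionAt N 2 q x, hLw q hq hqN x hx, ?_⟩
    change heckeT (Gamma0 N) 2 p (atkinLehnerInvolutionAt N 2 q x) = atkinLehnerInvolutionAt N 2 q (heckeT (Gamma0 N) 2 p x)
    exact (atkinLehnerInvolutionAt_heckeT_of_not_dvd' hq hqN hp hpN x).symm
  · -- `A₃`-stability
    rintro _ ⟨_, ⟨x, hx, rfl⟩, rfl⟩
    change diagonalOperatorAtThree N 2 (heckeT (Gamma0 N) 2 p x) ∈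
      L.map ((heckeT (Gamma0 N) 2 p).restrictScalars ℤ)
    -- `A₃ (T_p x) = t₁ (T_p x) − ζ₃ B₃ (T_p x) = T_p (t_p x) − ζ₃ (± T_p (B₃ x))`
    have hA : diagonalOperatorAtThree N 2 (heckeT (Gamma0 N) 2 p x) =
        thirdTranslate N 2 1 (heckeT (Gamma0 N) 2 p x) - zeta3 • twistOperatorAtThree N 2 (heckeT (Gamma0 N) 2 p x) := by
      simp only [diagonalOperatorAtThree, LinearMap.sub_apply, LinearMap.smul_apply]
    rcases hmod with h1 | h2
    · refine ⟨diagonalOperatorAtThree N 2 x, hLA x hx, ?_⟩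
      change heckeT (Gamma0 N) 2 p (diagonalOperatorAtThree N 2 x) = diagonalOperatorAtThree N 2 (heckeT (Gamma0 N) 2 p x)
      have key : thirdTranslate N 2 1 (heckeT (Gamma0 N) 2 p x) = heckeT (Gamma0 N) 2 p (thirdTranslate N 2 1 x) := by
        rw [heckeT_thirdTranslate h9 hp hp3 1,
          thirdTranslate_eq_of_modEq_three h9 (j := p * 1) (j' := 1) (by simpa using h1)]
      rw [hA, hTB, if_pos h1, one_smul, key, ht1, map_add, map_smul, add_sub_cancel_right]
    · refine ⟨diagonalOperatorAtThree N 2 x - twistOperatorAtThree N 2 x, L.sub_mem (hLA x hx) (hLB x hx), ?_⟩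
      change heckeT (Gamma0 N) 2 p (diagonalOperatorAtThree N 2 x - twistOperatorAtThree N 2 x) =
        diagonalOperatorAtThree N 2 (heckeT (Gamma0 N) 2 p x)
      have key : thirdTranslate N 2 1 (heckeT (Gamma0 N) 2 p x) = heckeT (Gamma0 N) 2 p (thirdTranslate N 2 2 x) := by
        rw [heckeT_thirdTranslate h9 hp hp3 2,
          thirdTranslate_eq_of_modEq_three h9 (j := p * 2) (j' := 1) (by simp [Nat.mul_mod, h2])]
      rw [hA, hTB, if_neg (by omega), key, ht2, map_add, map_smul, map_sub, smul_smul, zeta3_sq]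
      module
  · -- `B₃`-stability
    rintro _ ⟨_, ⟨x, hx, rfl⟩, rfl⟩
    change twistOperatorAtThree N 2 (heckeT (Gamma0 N) 2 p x) ∈ L.map ((heckeT (Gamma0 N) 2 p).restrictScalars ℤ)
    rw [hTB]
    rcases hmod with h1 | h2
    · rw [if_pos h1, one_smul]
      exact ⟨twistOperatorAtThree N 2 x, hLB x hx, rfl⟩
    · rw [if_neg (by omega), neg_one_smul, ← map_neg]
      exact ⟨-twistOperatorAtThree N 2 x, L.neg_mem (hLB x hx), rfl⟩

end Summit.BirchSwinnertonDyer.BirchSwinnertonDyer.Theorems.ManinLocalTwoThree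

end
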